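import Summits.AtomisticToContinuum.FouriersLaw.Theses.CageBudgetFekete
import Summits.AtomisticToContinuum.FouriersLaw.Theses.HoelderEscapeProfile
import Summits.AtomisticToContinuum.FouriersLaw.Theorems.HoelderEscapeProfileFibreCalculus
import Summits.AtomisticToContinuum.FouriersLaw.Theorems.CageBudgetFeketeUnboundedHeatVarianceAbelSandwichTransfer
import Summits.AtomisticToContinuum.FouriersLaw.Theorems.CageBudgetFeketeUnboundedHeatVarianceIrOfNoFrozenSiteEnergy
import Summits.AtomisticToContinuum.FouriersLaw.Theorems.HoelderEscapeProfileCornerNoDipSeam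
import Literature.Analysis.Fourier.CosineSeriesOrthogonality
import HarnessLib

/-!
# Stub `stub_infraredNonFreezing_of_bondHeatSpread` of line `Sketch` — bond heat spread ⟹ infrared non-freezing
(crux `CageBudgetFekete.UnboundedHeatVariance`, item stmt-AtomisticToContinuum-15771; `--supports` file)

WHAT. In the arena of the crux let `S(x,t)` be the energy kernel, `S̄_ν(x) = ν∫₀^∞ e^{-νt} S(x,t) dt` its Abel
profile, `f̂_ν(k) = Σ_x cos(kx) S̄_ν(x)` and `χ(k) = Σ_x cos(kx) S(x,0)`. If the ABEL SINGLE-BOND HEAT SPREAD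
`v_A(ν) = Σ_x |x| (S̄_ν(x) − S(x,0))` is unbounded above as `ν ↓ 0` (hypothesis BS), then for every `M` and every
`ν₁ > 0` some wavenumber `k` with `cos k ≠ 1` and some `0 < ν < ν₁` carry the infrared deficit
`χ(k) − f̂_ν(k) ≥ M (2 − 2cos k)` (conclusion IR).

HOW (the Fejér lever). With the displacement kernel `Δ = S̄_ν − S(·,0)` (`Σ Δ = 0` by conservation, landed fibre
calculus `FibreCalculusSketch.fibreCalculus_proof`, clauses 4, 5, 7) the deficit is the cosine-defect series
`d_ν(k) = χ(k) − f̂_ν(k) = Σ_x (1 − cos kx) Δ(x)` (`Sketch.tsum_one_sub_cos_mul_sub`). FEJÉR'S INTEGRAL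
`∫_{-π}^{π} (1 − cos kx)/(1 − cos k) dk = 2π|x|` (`integral_fejer_quotient_int`, by the three-term recurrence
`F_{a+2} + F_a = 2F_{a+1} + 2cos((a+1)k)` off the null set `cos k = 1` and `∫cos((a+1)k) = 0`) and termwise
integration (dominated convergence, majorant `x²|Δ x|` from the Chebyshev bound `0 ≤ F_x ≤ x²`,
`CornerNoDip.HeatProfile.one_sub_cos_int_mul_le`) give `∫_{-π}^{π} d_ν(k)/(1 − cos k) dk = 2π v_A(ν)`: the bond spread
is the `k`-average of the fibre quotients, so `v_A(ν) > 2M` forces `d_ν(k)/(1 − cos k) ≥ 2M` at some `k` with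
`cos k ≠ 1` (`exists_fibre_deficit_of_bondSpread`), which is IR's inequality.

No definitions; pure real analysis helper lemmas first, then the stub (registered signature, verbatim).
prover-line-stmt-AtomisticToContinuum-15771-c1-0, 2026-08-17.
-/

noncomputable section

namespace Summit.AtomisticToContinuum.FouriersLaw.Theorems.UnboundedHeatVariance.Sketch

open MeasureTheory Set Filter Topology
open Literature.MathematicalPhysics.KineticTheory.HeatConduction
open Summit.AtomisticToContinuum.FouriersLaw.Theorems.CornerNoDip

/-! ### 1. The Fejér quotient `(1 − cos kx)/(1 − cos k)` -/

/-- Lebesgue-almost every real `k` has `cos k ≠ 1` (the exceptional set `2πℤ` is countable). [folklore] -/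
theorem ae_cos_ne_one : ∀ᵐ k : ℝ, Real.cos k ≠ 1 := by
  have hc : ({k : ℝ | Real.cos k = 1}).Countable := by
    have e : {k : ℝ | Real.cos k = 1} = Set.range (fun n : ℤ => (n : ℝ) * (2 * Real.pi)) := by
      ext k
      simp only [Set.mem_setOf_eq, Set.mem_range, Real.cos_eq_one_iff]
    rw [e]
    exact Set.countable_range _
  rw [ae_iff]
  simp only [ne_eq, not_not]
  exact hc.measure_zero _

/-- Three-term recurrence of the Fejér quotients `F_a(k) = (1 − cos(ka))/(1 − cos k)` off the null set
`cos k = 1`: `F_{a+2} + F_a = 2F_{a+1} + 2cos((a+1)k)` (sum-to-product). [folklore] -/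
theorem fejer_recurrence (a k : ℝ) (hk : Real.cos k ≠ 1) :
    (1 - Real.cos (k * (a + 2))) / (1 - Real.cos k) + (1 - Real.cos (k * a)) / (1 - Real.cos k) =
      2 * ((1 - Real.cos (k * (a + 1))) / (1 - Real.cos k)) + 2 * Real.cos (k * (a + 1)) := by
  have h0 : 1 - Real.cos k ≠ 0 := sub_ne_zero.2 (Ne.symm hk)
  have e1 : Real.cos (k * (a + 2)) = Real.cos (k * (a + 1) + k) := by
    congr 1
    ring
  have e2 : Real.cos (k * a) = Real.cos (k * (a + 1) - k) := by
    congr 1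
    ring
  rw [e1, e2, Real.cos_add, Real.cos_sub]
  field_simp
  ring

/-- Chebyshev bounds on the Fejér quotient: `0 ≤ (1 − cos kx)/(1 − cos k) ≤ x²` for `x ∈ ℤ` and every real `k`
(at `cos k = 1` the quotient is `0` by the division convention). [folklore] -/
theorem fejer_quotient_bounds (x : ℤ) (k : ℝ) :
    0 ≤ (1 - Real.cos (k * (x : ℝ))) / (1 - Real.cos k) ∧
      (1 - Real.cos (k * (x : ℝ))) / (1 - Real.cos k) ≤ (x : ℝ) ^ 2 := by
  by_cases hk : Real.cos k = 1
  · rw [hk, sub_self, div_zero]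
    exact ⟨le_rfl, sq_nonneg _⟩
  · have hpos : 0 < 1 - Real.cos k := sub_pos.2 (lt_of_le_of_ne (Real.cos_le_one k) hk)
    refine ⟨div_nonneg (sub_nonneg.2 (Real.cos_le_one _)) hpos.le, ?_⟩
    rw [div_le_iff₀ hpos]
    exact HeatProfile.one_sub_cos_int_mul_le x k

/-- The Fejér quotient is measurable in `k`. [folklore] -/
theorem fejer_quotient_measurable (a : ℝ) :
    Measurable (fun k : ℝ => (1 - Real.cos (k * a)) / (1 - Real.cos k)) :=
  (measurable_const.sub (Real.measurable_cos.comp (measurable_id.mul_const a))).div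
    (measurable_const.sub Real.measurable_cos)

/-- The Fejér quotient of an integer frequency is interval integrable (measurable and bounded by `x²`).
[folklore] -/
theorem fejer_quotient_intervalIntegrable (x : ℤ) (a b : ℝ) :
    IntervalIntegrable (fun k : ℝ => (1 - Real.cos (k * (x : ℝ))) / (1 - Real.cos k)) volume a b := by
  refine (intervalIntegrable_const (c := (x : ℝ) ^ 2)).mono_fun'
    (fejer_quotient_measurable (x : ℝ)).aestronglyMeasurable (Eventually.of_forall fun k => ?_)
  dsimp only
  rw [Real.norm_eq_abs, abs_of_nonneg (fejer_quotient_bounds x k).1]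
  exact (fejer_quotient_bounds x k).2

/-- **Fejér's integral** at natural frequencies: `∫_{-π}^{π} (1 − cos kn)/(1 − cos k) dk = 2πn` for `n ∈ ℕ`
(two-step induction on `fejer_recurrence`, integrated a.e., with `∫_{-π}^{π} cos((n+1)k) dk = 0`). [folklore] -/
theorem integral_fejer_quotient_nat : ∀ n : ℕ,
    ∫ k in (-Real.pi)..Real.pi, (1 - Real.cos (k * (n : ℝ))) / (1 - Real.cos k) = 2 * Real.pi * n
  | 0 => by simp
  | 1 => by
    have e : ∫ k in (-Real.pi)..Real.pi, (1 - Real.cos (k * ((1 : ℕ) : ℝ))) / (1 - Real.cos k) =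
        ∫ _k in (-Real.pi)..Real.pi, (1 : ℝ) :=
      intervalIntegral.integral_congr_ae (ae_cos_ne_one.mono fun k hk _ => by
        rw [Nat.cast_one, mul_one, div_self (sub_ne_zero.2 (Ne.symm hk))])
    rw [e, intervalIntegral.integral_const, smul_eq_mul, Nat.cast_one]
    ring
  | (n + 2) => by
    have ih0 := integral_fejer_quotient_nat n
    have ih1 := integral_fejer_quotient_nat (n + 1)
    push_cast at ih1 ⊢
    have hI0 : IntervalIntegrable (fun k : ℝ => (1 - Real.cos (k * (n : ℝ))) / (1 - Real.cos k))
        volume (-Real.pi) Real.pi := by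
      simpa using fejer_quotient_intervalIntegrable (n : ℤ) (-Real.pi) Real.pi
    have hI1 : IntervalIntegrable (fun k : ℝ => (1 - Real.cos (k * ((n : ℝ) + 1))) / (1 - Real.cos k))
        volume (-Real.pi) Real.pi := by
      simpa using fejer_quotient_intervalIntegrable ((n : ℤ) + 1) (-Real.pi) Real.pi
    have hcI : IntervalIntegrable (fun k : ℝ => Real.cos (k * ((n : ℝ) + 1))) volume (-Real.pi) Real.pi :=
      (Real.continuous_cos.comp (continuous_id.mul continuous_const)).intervalIntegrable _ _
    have hcos : ∫ k in (-Real.pi)..Real.pi, Real.cos (k * ((n : ℝ) + 1)) = 0 := by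
      have e := Literature.Analysis.Fourier.intervalIntegral_cos_mul_int ((n : ℤ) + 1)
      rw [if_neg (by omega)] at e
      simpa using e
    have e : ∫ k in (-Real.pi)..Real.pi, (1 - Real.cos (k * ((n : ℝ) + 2))) / (1 - Real.cos k) =
        ∫ k in (-Real.pi)..Real.pi, ((2 * ((1 - Real.cos (k * ((n : ℝ) + 1))) / (1 - Real.cos k))
          + 2 * Real.cos (k * ((n : ℝ) + 1))) - (1 - Real.cos (k * (n : ℝ))) / (1 - Real.cos k)) :=
      intervalIntegral.integral_congr_ae (ae_cos_ne_one.mono fun k hk _ => by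
        linarith [fejer_recurrence (n : ℝ) k hk])
    rw [e, intervalIntegral.integral_sub ((hI1.const_mul 2).add (hcI.const_mul 2)) hI0,
      intervalIntegral.integral_add (hI1.const_mul 2) (hcI.const_mul 2), intervalIntegral.integral_const_mul,
      intervalIntegral.integral_const_mul, hcos, ih1, ih0]
    ring

/-- **Fejér's integral** at integer frequencies: `∫_{-π}^{π} (1 − cos kx)/(1 − cos k) dk = 2π|x|` for `x ∈ ℤ`.
[folklore] -/
theorem integral_fejer_quotient_int (x : ℤ) :
    ∫ k in (-Real.pi)..Real.pi, (1 - Real.cos (k * (x : ℝ))) / (1 - Real.cos k) = 2 * Real.pi * |(x : ℝ)| := by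
  obtain ⟨n, rfl | rfl⟩ := Int.eq_nat_or_neg x
  · simpa [Nat.abs_cast] using integral_fejer_quotient_nat n
  · simpa [Real.cos_neg, Nat.abs_cast] using integral_fejer_quotient_nat n

/-! ### 2. Fejér averaging of a cosine-defect series -/

/-- Termwise bound `‖F_x(k) c(x)‖ ≤ x²|c x|` for the Fejér quotient `F_x`. [folklore] -/
theorem norm_fejer_quotient_mul_le (c : ℤ → ℝ) (x : ℤ) (k : ℝ) :
    ‖(1 - Real.cos (k * (x : ℝ))) / (1 - Real.cos k) * c x‖ ≤ (x : ℝ) ^ 2 * |c x| := by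
  rw [Real.norm_eq_abs, abs_mul, abs_of_nonneg (fejer_quotient_bounds x k).1]
  exact mul_le_mul_of_nonneg_right (fejer_quotient_bounds x k).2 (abs_nonneg _)

/-- A sequence with `Σ(1+x²)|c x| < ∞` has `Σ x²|c x| < ∞`. [folklore] -/
theorem summable_sq_mul_abs_of_weighted {c : ℤ → ℝ}
    (hc : Summable (fun x : ℤ => (1 + (x : ℝ) ^ 2) * |c x|)) :
    Summable (fun x : ℤ => (x : ℝ) ^ 2 * |c x|) :=
  Summable.of_nonneg_of_le (fun x => by positivity)
    (fun x => by nlinarith [abs_nonneg (c x), sq_nonneg (x : ℝ)]) hc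

/-- **Fejér averaging of a lattice cosine-defect series.** For `Σ(1+x²)|c x| < ∞`:
`∫_{-π}^{π} Σ_x (1 − cos kx)/(1 − cos k)·c(x) dk = 2π Σ_x |x| c(x)` (termwise integration by dominated
convergence with the summable majorant `x²|c x|`, and `integral_fejer_quotient_int`).
-- adapted from `Literature.Analysis.Fourier.integral_tsum_cos_mul_eq`. [folklore] -/
theorem integral_tsum_fejer_quotient_mul (c : ℤ → ℝ)
    (hc : Summable (fun x : ℤ => (1 + (x : ℝ) ^ 2) * |c x|)) :
    ∫ k in (-Real.pi)..Real.pi, ∑' x : ℤ, (1 - Real.cos (k * (x : ℝ))) / (1 - Real.cos k) * c x =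
      2 * Real.pi * ∑' x : ℤ, |(x : ℝ)| * c x := by
  have hmaj := summable_sq_mul_abs_of_weighted hc
  have hmode : ∀ x : ℤ, ∫ k in (-Real.pi)..Real.pi, (1 - Real.cos (k * (x : ℝ))) / (1 - Real.cos k) * c x
      = 2 * Real.pi * (|(x : ℝ)| * c x) := fun x => by
    rw [intervalIntegral.integral_mul_const, integral_fejer_quotient_int]
    ring
  have hsum : HasSum
      (fun x : ℤ => ∫ k in (-Real.pi)..Real.pi, (1 - Real.cos (k * (x : ℝ))) / (1 - Real.cos k) * c x)
      (∫ k in (-Real.pi)..Real.pi, ∑' x : ℤ, (1 - Real.cos (k * (x : ℝ))) / (1 - Real.cos k) * c x) := by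
    refine intervalIntegral.hasSum_integral_of_dominated_convergence (fun x _ => (x : ℝ) ^ 2 * |c x|)
      (fun x => ?_) (fun x => ?_) ?_ ?_ ?_
    · exact ((fejer_quotient_measurable (x : ℝ)).mul_const (c x)).aestronglyMeasurable
    · exact Eventually.of_forall fun k _ => norm_fejer_quotient_mul_le c x k
    · exact Eventually.of_forall fun k _ => hmaj
    · exact intervalIntegrable_const
    · exact Eventually.of_forall fun k _ => (hmaj.of_norm_bounded fun x => norm_fejer_quotient_mul_le c x k).hasSum
  rw [← hsum.tsum_eq, tsum_congr hmode, tsum_mul_left]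

/-- **A large bond spread forces a large fibre quotient.** For weighted-summable `a, b : ℤ → ℝ` with equal sums
(conservation), if `2M < Σ_x |x| (a x − b x)` then at some wavenumber `k` with `cos k ≠ 1`,
`M (2 − 2cos k) ≤ Σ_x cos(kx) b x − Σ_x cos(kx) a x`: the deficit `d(k) = Σ cos(kx) b − Σ cos(kx) a` equals
`Σ_x (1 − cos kx)(a − b)(x)` (`tsum_one_sub_cos_mul_sub`), the quotient `d(k)/(1 − cos k)` is interval integrable
with `∫_{-π}^{π} d(k)/(1 − cos k) dk = 2π Σ_x |x|(a − b)(x)` (`integral_tsum_fejer_quotient_mul`), and a function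
`≤ 2M` almost everywhere has integral `≤ 4πM`. [folklore] -/
theorem exists_fibre_deficit_of_bondSpread {a b : ℤ → ℝ}
    (ha : Summable (fun x : ℤ => (1 + (x : ℝ) ^ 2) * |a x|))
    (hb : Summable (fun x : ℤ => (1 + (x : ℝ) ^ 2) * |b x|))
    (hcons : ∑' x : ℤ, a x = ∑' x : ℤ, b x) {M : ℝ}
    (hM : 2 * M < ∑' x : ℤ, |(x : ℝ)| * (a x - b x)) :
    ∃ k : ℝ, Real.cos k ≠ 1 ∧ M * (2 - 2 * Real.cos k) ≤
      (∑' x : ℤ, Real.cos (k * (x : ℝ)) * b x) - ∑' x : ℤ, Real.cos (k * (x : ℝ)) * a x := by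
  by_contra hcon
  push Not at hcon
  have hΔ := weighted_summable_sub ha hb
  obtain ⟨W, hW⟩ : ∃ W : ℝ → ℝ, ∀ k, W k = ((∑' x : ℤ, Real.cos (k * (x : ℝ)) * b x) -
      ∑' x : ℤ, Real.cos (k * (x : ℝ)) * a x) / (1 - Real.cos k) := ⟨_, fun k => rfl⟩
  -- the fibre quotient as a Fejér series
  have hWs : ∀ k, W k = ∑' x : ℤ, (1 - Real.cos (k * (x : ℝ))) / (1 - Real.cos k) * (a x - b x) :=
    fun k => by
    rw [hW k, ← tsum_one_sub_cos_mul_sub ha hb hcons k, ← tsum_div_const]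
    exact tsum_congr fun x => by ring
  -- its average is the bond spread
  have hint : ∫ k in (-Real.pi)..Real.pi, W k = 2 * Real.pi * ∑' x : ℤ, |(x : ℝ)| * (a x - b x) := by
    simp_rw [hWs]
    exact integral_tsum_fejer_quotient_mul _ hΔ
  -- it is interval integrable (measurable, bounded by `Σ x²|a − b|`)
  have hWi : IntervalIntegrable W volume (-Real.pi) Real.pi := by
    have hm : Measurable W := by
      rw [funext hW]
      exact ((cosSeries_continuous b hb).sub (cosSeries_continuous a ha)).measurable.div
        (measurable_const.sub Real.measurable_cos)
    refine (intervalIntegrable_const (c := ∑' x : ℤ, (x : ℝ) ^ 2 * |a x - b x|)).mono_fun'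
      hm.aestronglyMeasurable (Eventually.of_forall fun k => ?_)
    dsimp only
    rw [hWs k]
    exact tsum_of_norm_bounded (summable_sq_mul_abs_of_weighted hΔ).hasSum
      fun x => norm_fejer_quotient_mul_le (fun y => a y - b y) x k
  -- but it is `≤ 2M` almost everywhere
  have hle : W ≤ᵐ[volume] fun _ => 2 * M := ae_cos_ne_one.mono fun k hk => by
    have hpos : 0 < 1 - Real.cos k := sub_pos.2 (lt_of_le_of_ne (Real.cos_le_one k) hk)
    show W k ≤ 2 * M
    rw [hW k, div_le_iff₀ hpos]
    linarith [hcon k hk]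
  have hI := intervalIntegral.integral_mono_ae (by linarith [Real.pi_pos]) hWi intervalIntegrable_const hle
  rw [hint, intervalIntegral.integral_const, smul_eq_mul] at hI
  nlinarith [mul_pos (sub_pos.2 hM) Real.pi_pos]

/-! ### 3. The stub -/

/-- **Stub `stub_infraredNonFreezing_of_bondHeatSpread`** (edge BondHeatSpread ⟹ IR of line `Sketch` of
`CageBudgetFekete.UnboundedHeatVariance`; registered signature, verbatim). In the arena of the crux, with the energy
kernel `S`, its Abel profile `Sb`, the Abel structure factor `fh ν k = Σ_x cos(kx) Sb ν x` and the static one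
`χk k = Σ_x cos(kx) S x 0`: if the Abel single-bond heat spread `Σ_x |x| (Sb ν x − S x 0)` is unbounded above as
`ν ↓ 0`, then for every `M` and every `ν₁ > 0` some wavenumber `k` with `cos k ≠ 1` and some `0 < ν < ν₁` have
`M (2 − 2cos k) ≤ χk k − fh ν k` — Fejér averaging (`exists_fibre_deficit_of_bondSpread`) over the landed fibre
calculus (`FibreCalculusSketch.fibreCalculus_proof`, clauses 4, 5, 7). -/
theorem stub_infraredNonFreezing_of_bondHeatSpread :
    ∀ ω₂ lam β γ : ℝ, 0 < ω₂ → 0 < lam → 0 < β → ∀ T : ℝ, 0 < T → ∀ μ : MeasureTheory.Measure Literature.MathematicalPhysics.KineticTheory.HeatConduction.ChainConfig, (Literature.MathematicalPhysics.KineticTheory.HeatConduction.pinnedChain ω₂ lam β γ).IsChainGibbsMeasure T μ → Literature.MathematicalPhysics.KineticTheory.HeatConduction.IsShiftInvariant μ → μ.map (fun σ : Literature.MathematicalPhysics.KineticTheory.HeatConduction.ChainConfig => fun x : ℤ => ((σ x).1, -(σ x).2)) = μ → ∀ D : Literature.MathematicalPhysics.KineticTheory.HeatConduction.InfiniteChainDynamics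 (Literature.MathematicalPhysics.KineticTheory.HeatConduction.pinnedChain ω₂ lam β γ), D.PreservesMeasure μ → (∀ t : ℝ, ∀ᵐ σ ∂μ, D.flow t (Literature.MathematicalPhysics.KineticTheory.HeatConduction.shift σ) = Literature.MathematicalPhysics.KineticTheory.HeatConduction.shift (D.flow t σ)) → (∀ t : ℝ, D.HasAbsConvergentCorrelation μ t) → Continuous (fun t : ℝ => D.currentCorrelation μ t) → ∀ h : Literature.MathematicalPhysics.KineticTheory.HeatConduction.ChainConfig → ℤ → ℝ, h = (fun (σ : Literature.MathematicalPhysics.KineticTheory.HeatConduction.ChainConfig) (x : ℤ) => (σ x).2 ^ 2 / 2 + (Literature.MathematicalPhysics.KineticTheory.HeatConduction.pinnedChain ω₂ lam β γ).U (σ x).1 + ((Literature.MathematicalPhysics.KineticTheory.HeatConduction.pinnedChain ω₂ lam β γ).V ((σ (x + 1)).1 - (σ x).1) + (Literature.MathematicalPhysics.KineticTheory.HeatConduction.pinnedChain ω₂ lam β γ).V ((σ x).1 - (σ (x - 1)).1)) / 2) → ∀ S : ℤ → ℝ → ℝ, S = (fun (x : ℤ) (t : ℝ) => ∫ σ, (h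 σ 0 - ∫ σ', h σ' 0 ∂μ) * (h (D.flow t σ) x - ∫ σ', h σ' 0 ∂μ) ∂μ) → ∀ Sb : ℝ → ℤ → ℝ, Sb = (fun (ν : ℝ) (x : ℤ) => ν * ∫ t in Set.Ioi (0:ℝ), Real.exp (-(ν * t)) * S x t) → ∀ fh : ℝ → ℝ → ℝ, fh = (fun (ν k : ℝ) => ∑' x : ℤ, Real.cos (k * (x : ℝ)) * Sb ν x) → ∀ χk : ℝ → ℝ, χk = (fun k : ℝ => ∑' x : ℤ, Real.cos (k * (x : ℝ)) * S x 0) → (∀ M ν₁ : ℝ, 0 < ν₁ → ∃ ν : ℝ, 0 < ν ∧ ν < ν₁ ∧ M ≤ ∑' x : ℤ, |(x : ℝ)| * (Sb ν x - S x 0)) → ∀ M ν₁ : ℝ, 0 < ν₁ → ∃ k : ℝ, Real.cos k ≠ 1 ∧ ∃ ν : ℝ, 0 < ν ∧ ν < ν₁ ∧ M * (2 - 2 * Real.cos k) ≤ χk k - fh ν k := by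
  intro ω₂ lam β γ hω hl hβ T hT μ hG hSI hRefl D hP hShift _ _ h hh S hS Sb hSb fh hfh χk hχk hBS M ν₁ hν₁
  obtain ⟨ν, hν, hνν₁, hv⟩ := hBS (2 * M + 1) ν₁ hν₁
  obtain ⟨-, -, -, h4, h5, -, h7, -, -, -, -, -⟩ :=
    Summit.AtomisticToContinuum.FouriersLaw.Theorems.FibreCalculusSketch.fibreCalculus_proof ω₂ lam β γ hω hl hβ T
      hT μ hG hSI hRefl D hP hShift h hh S hS Sb hSb _ rfl _ rfl fh hfh χk hχk
  have hχ0 : χk 0 = ∑' x : ℤ, S x 0 := by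
    rw [hχk]
    simp only [zero_mul, Real.cos_zero, one_mul]
  obtain ⟨k, hk, hMk⟩ := exists_fibre_deficit_of_bondSpread (b := fun x => S x 0) (M := M) (h4 ν hν) h5
    ((h7 ν hν).trans hχ0) (lt_of_lt_of_le (by linarith) hv)
  refine ⟨k, hk, ν, hν, hνν₁, ?_⟩
  simpa only [hfh, hχk] using hMk

end Summit.AtomisticToContinuum.FouriersLaw.Theorems.UnboundedHeatVariance.Sketch

end
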